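import Literature.Probability.Distributions.IndepProductLawKernels
import Literature.Computability.Cryptography.SIS
import HarnessLib

/-!
# Micciancio–Regev 2007, proof of Thm. 5.9 (`IncGDD → SIS`): the probability bookkeeping at the `PMF` level — proved

Topic `Computability/Cryptography` (family `pqc`). Theorems only (no definitions, no named facts).
Serves the decomposition of the named facts
`Literature.Computability.Cryptography.MicciancioRegev2007_gapCVP'_to_SIS'` (MR07 Thm. 5.23 proper,
`GapSVPToSIS.lean`, whose first step is Cor. 5.13 = Thm. 5.9 iterated by Lemma 5.10) and
`Literature.Computability.Cryptography.owfExist_of_gapSVP_worstCaseHard` (whose one remaining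
hypothesis, `GapSVPFromGIVP.lean`, is the machine-level Cor. 5.13). The analytic heart of Thm. 5.9
is in the tree in measure-theoretic form (`MRIncGDDSuccess.lean`: for independent `yᵢ ∼ D_{Λ,s,cᵢ+tᵢ}`
under a probability measure, `Pr[‖S‖/g + r < ‖s − t‖] ≤ 2/3`); the machine layer of the fleet is
`PMF`-based (`RandAlg.outputPMF`, `SIS.successProb = matrixAvg (A ↦ B.pr …)`, `indepLaw`). This file
supplies the three probability steps of the printed proof (authors' version pp. 22–24) in exactly
that `PMF` form:

* `SIS.exists_guess` — **the guessing step** (p. 22 step 1 and p. 23 top: "since any nonzero vector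
  `z ∈ ℤᵐ` with `‖z‖ ≤ β` must have at least one coordinate in `B = {−β,…,−1,1,…,β}`,
  `∑_{j′,α′} δ_{j′,α′} ≥ δ`. Hence there must exist some `j′, α′` for which `δ_{j′,α′} ≥ δ/2βm`"):
  for ANY randomized oracle `B` and any family of "success" events `E_A` whose members decode to
  nonzero vectors of norm `≤ β`, some pair `(j, a)`, `a ≠ 0`, `|a| ≤ β`, has
  `matrixAvg (A ↦ Pr[B(A) ∈ E_A ∧ z_j = a]) ≥ matrixAvg (A ↦ Pr[B(A) ∈ E_A]) / (2βm)`
  (with `SIS.exists_coord_ne_zero_abs_le`, `PMF.toReal_toOuterMeasure_biUnion_finset_le`);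
* `PMF.mul_toReal_toOuterMeasure_le_bind_pair` — **the conditioning step** (p. 23: "we show that
  the success probability of the reduction conditioned on `H` is at least `1/3` … conditioned on any
  fixed values of `C`, `A`, `z` for which `H` is satisfied"): for a prior `μ` and a kernel `κ`, if
  `κ_ω(G_ω) ≥ θ` for every `ω ∈ H` then `Pr_{(ω,λ) ∼ μ ⋉ κ}[G] ≥ θ · μ(H)`;
* `PMF.mul_sub_tvDist_le_toReal_experiment` — **the whole probability skeleton of the proof**
  (p. 23): for a first stage `c ∼ μC` (offsets), a query kernel `κA` (combining procedure), an
  oracle kernel `O`, a conditionally independent stage `y ∼ κY(c)` (the lattice vectors given the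
  offsets, Lemma 5.7) and any reference query law `U`: if the success event has conditional
  probability `≥ θ` given any `(c, A, z)` with `(A, z) ∈ H₀`, then
  `Pr[success] ≥ θ · (Pr_{A ∼ U, z ∼ O(A)}[H₀] − Δ(law A, U))` — i.e. "`H` holds with probability at
  least `δ_{j,α} −` (13), and conditioned on `H` the reduction succeeds with probability `1/3`";
* (in `Algebra/EuclideanLattices/MRIncGDDSuccessPMF.lean`) the conditional success `≥ 1/3` read at
  the `PMF` level for the product law `⨂ᵢ D_{Λ,s,cᵢ+tᵢ}` — the `θ = 1/3` fed to the skeleton.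

The remaining step of the printed proof at this level — "by (13) and Lemma 5.8 the event `H` holds
with probability at least `δ_{j,α} − εm/2`" — is `MRCombiningQuery.lean`
(`tvDist_indepLaw_query_matrix_le`) with `PMF.abs_toReal_toOuterMeasure_bind_sub_le_tvDist`.

## References

* D. Micciancio, O. Regev, *Worst-case to average-case reductions based on Gaussian measures*,
  SIAM J. Comput. 37 (2007) 267–302; authors' version (`lit read doi:10.1137/S0097539705447360`),
  Thm. 5.9 and its proof, pp. 22–24.
-/

noncomputable section

open scoped ENNReal
open MeasureTheory Finset

/-! ### Finite union bound and the conditioning step for `PMF`s -/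

namespace PMF

variable {Ω Λ : Type*}

/-- A `PMF` gives finite mass to every set. [folklore] -/
theorem toOuterMeasure_ne_top (p : PMF Ω) (S : Set Ω) : p.toOuterMeasure S ≠ ∞ :=
  ne_top_of_le_ne_top ENNReal.one_ne_top
    ((p.toOuterMeasure_mono (Set.subset_univ _)).trans_eq
      ((p.toOuterMeasure_apply_eq_one_iff Set.univ).2 (Set.subset_univ _)))

/-- **Finite union bound** for a `PMF`, real-valued form:
`Pr[⋃_{k ∈ K} E_k] ≤ ∑_{k ∈ K} Pr[E_k]`. [folklore] -/
theorem toReal_toOuterMeasure_biUnion_finset_le {ι : Type*} (p : PMF Ω) (K : Finset ι)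
    (E : ι → Set Ω) :
    (p.toOuterMeasure (⋃ k ∈ K, E k)).toReal ≤ ∑ k ∈ K, (p.toOuterMeasure (E k)).toReal := by
  rw [← ENNReal.toReal_sum fun k _ => p.toOuterMeasure_ne_top (E k)]
  exact ENNReal.toReal_mono (ENNReal.sum_ne_top.2 fun k _ => p.toOuterMeasure_ne_top (E k))
    (measure_biUnion_finset_le K E)

/-- **Conditioning on a good event of the first stage** (MR07 p. 23: "the success probability …
conditioned on `H` is at least `1/3` … conditioned on any fixed values … for which `H` is
satisfied"): for a prior `μ` on `Ω`, a kernel `κ : Ω → PMF Λ`, an event `H ⊆ Ω` and a target event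
`G ⊆ Ω × Λ`, if `κ_ω({λ | (ω, λ) ∈ G}) ≥ θ` for every `ω ∈ H`, then under the joint law
`ω ∼ μ, λ ∼ κ_ω` one has `Pr[G] ≥ θ · μ(H)`. [cite: MicciancioRegev2007, Thm. 5.9 (proof, p. 23)] -/
theorem mul_toReal_toOuterMeasure_le_bind_pair (μ : PMF Ω) (κ : Ω → PMF Λ) (H : Set Ω)
    (G : Set (Ω × Λ)) {θ : ℝ}
    (h : ∀ ω ∈ H, θ ≤ ((κ ω).toOuterMeasure {l | (ω, l) ∈ G}).toReal) :
    θ * (μ.toOuterMeasure H).toReal ≤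
      ((μ.bind fun ω => (κ ω).map (Prod.mk ω)).toOuterMeasure G).toReal := by
  classical
  rw [toReal_toOuterMeasure_bind_apply, toReal_toOuterMeasure_apply, ← tsum_mul_left]
  have hs : Summable fun ω => (μ ω).toReal * (((κ ω).map (Prod.mk ω)).toOuterMeasure G).toReal :=
    summable_toReal_mul_of_abs_le_one μ fun ω => by
      rw [abs_of_nonneg ENNReal.toReal_nonneg]; exact toReal_toOuterMeasure_le_one _ _
  have hi : Summable fun ω => θ * H.indicator (fun ω => (μ ω).toReal) ω :=
    ((summable_coe_toReal μ).indicator H).mul_left θ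
  refine hi.tsum_le_tsum (fun ω => ?_) hs
  by_cases hω : ω ∈ H
  · rw [Set.indicator_of_mem hω, PMF.toOuterMeasure_map_apply, mul_comm]
    exact mul_le_mul_of_nonneg_left (h ω hω) ENNReal.toReal_nonneg
  · rw [Set.indicator_of_notMem hω, mul_zero]
    positivity

/-- **The probability skeleton of MR07 Thm. 5.9** (p. 23). Stages: offsets `c ∼ μC`; query
`A ∼ κA(c)` (the combining procedure with its own coins) and answer `z ∼ O(A)` (the oracle); and,
conditionally independent of `(A, z)` given `c`, the lattice vectors `y ∼ κY(c)`. If for every `c`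
and every `(A, z)` in the oracle-success event `H₀` the reduction succeeds with probability `≥ θ`
over `y` (the "conditioned on any fixed values of `C`, `A`, `z` for which `H` is satisfied" of
p. 23), then `Pr[success] ≥ θ · (Pr_{A ∼ U, z ∼ O(A)}[H₀] − Δ(law A, U))` for any reference law `U`
of the query (uniform, in MR07: `Pr_U[H₀] = δ_{j,α}` and `Δ ≤ εm/2` by (13) and Lemma 5.8).
[cite: MicciancioRegev2007, Thm. 5.9 (proof, p. 23)] -/
theorem mul_sub_tvDist_le_toReal_experiment {C Aq Z Y : Type*} (μC : PMF C) (κA : C → PMF Aq)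
    (O : Aq → PMF Z) (κY : C → PMF Y) (U : PMF Aq) (H₀ : Set (Aq × Z))
    (S : Set ((C × (Aq × Z)) × Y)) {θ : ℝ} (hθ : 0 ≤ θ)
    (hcond : ∀ c az, az ∈ H₀ → θ ≤ ((κY c).toOuterMeasure {y | ((c, az), y) ∈ S}).toReal) :
    θ * ((((U.bind fun A => (O A).map (Prod.mk A)).toOuterMeasure H₀).toReal) -
        (μC.bind κA).tvDist U) ≤
      ((μC.bind fun c => (κY c).bind fun y =>
          ((κA c).bind fun A => (O A).map (Prod.mk A)).map fun az => ((c, az), y)).toOuterMeasure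
        S).toReal := by
  set κR : C → PMF (Aq × Z) := fun c => (κA c).bind fun A => (O A).map (Prod.mk A) with hκR
  -- swap the conditionally independent stages `y` and `(A, z)`
  rw [bind_bind_map_comm μC κY κR]
  -- condition on `H = {(c, (A, z)) | (A, z) ∈ H₀}`
  refine le_trans ?_ (mul_toReal_toOuterMeasure_le_bind_pair _ _ {cr : C × (Aq × Z) | cr.2 ∈ H₀} S
    fun cr hcr => hcond cr.1 cr.2 hcr)
  refine mul_le_mul_of_nonneg_left ?_ hθ
  -- the law of `(A, z)` is `(law A) ≫= (A ↦ (A, O A))`, within `Δ(law A, U)` of the reference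
  have hsnd : (μC.bind fun c => (κR c).map (Prod.mk c)).toOuterMeasure {cr | cr.2 ∈ H₀} =
      (((μC.bind κA).bind fun A => (O A).map (Prod.mk A)).toOuterMeasure H₀) := by
    rw [show {cr : C × (Aq × Z) | cr.2 ∈ H₀} = Prod.snd ⁻¹' H₀ from rfl,
      ← PMF.toOuterMeasure_map_apply, PMF.map_bind, PMF.bind_bind]
    refine congrArg (fun p : PMF (Aq × Z) => p.toOuterMeasure H₀) (congrArg μC.bind (funext fun c => ?_))
    rw [PMF.map_comp]
    exact PMF.map_id (κR c)
  rw [hsnd]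
  have h := abs_toReal_toOuterMeasure_bind_sub_le_tvDist (μC.bind κA) U
    (fun A => (O A).map (Prod.mk A)) H₀
  rw [abs_le] at h
  linarith [h.1]

end PMF

/-! ### The guessing step -/

namespace Literature.Computability.Cryptography.SIS

open Literature.Computability.Complexity Literature.Algebra.EuclideanLattices

variable {m : ℕ}

/-- Every coordinate is bounded by the Euclidean norm: `|zⱼ| ≤ ‖z‖`. [folklore] -/
theorem abs_cast_le_norm_intVecToEuclidean (z : Fin m → ℤ) (j : Fin m) :
    |(z j : ℝ)| ≤ ‖intVecToEuclidean m z‖ := by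
  rw [norm_intVecToEuclidean, ← Real.sqrt_sq_eq_abs]
  exact Real.sqrt_le_sqrt (Finset.single_le_sum (fun i _ => sq_nonneg ((z i : ℝ))) (Finset.mem_univ j))

/-- "Any nonzero vector `z ∈ ℤᵐ` with `‖z‖ ≤ β` must have at least one coordinate in the set
`B = {−β, …, −1, 1, …, β}`" (p. 23, first line). [cite: MicciancioRegev2007, Thm. 5.9 (proof, p. 23)] -/
theorem exists_coord_ne_zero_abs_le {z : Fin m → ℤ} (hz : z ≠ 0) {β : ℝ}
    (hβ : ‖intVecToEuclidean m z‖ ≤ β) : ∃ j, z j ≠ 0 ∧ |(z j : ℝ)| ≤ β := by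
  obtain ⟨j, hj⟩ := Function.ne_iff.1 hz
  exact ⟨j, hj, (abs_cast_le_norm_intVecToEuclidean z j).trans hβ⟩

/-- The box `B = {−T, …, −1, 1, …, T}` has `2T` elements. [folklore] -/
theorem card_Icc_erase_zero (T : ℕ) :
    ((Finset.Icc (-(T : ℤ)) T).erase 0).card = 2 * T := by
  rw [Finset.card_erase_of_mem (by simp), Int.card_Icc]
  omega

/-- **MR07 Thm. 5.9, the guessing step** (p. 22 step 1, p. 23 top). Let `B` be any randomized
oracle, read on `ℤ_q^{n×m}` through `encodeMatrix`/`decodeIntVec` as in `SIS.successProb`, and let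
`E_A` be "success" events all of whose members decode to a NONZERO `z` with `‖z‖ ≤ β` (e.g.
`{w | IsSolution A β (decodeIntVec m w)}`, or the SIS′ events). Writing
`δ = matrixAvg (A ↦ Pr[B(A) ∈ E_A])` and `δ_{j,a} = matrixAvg (A ↦ Pr[B(A) ∈ E_A ∧ z_j = a])`: since every
such `z` has a coordinate `z_j = a` with `a ≠ 0`, `|a| ≤ β` (a set of `m · 2⌊β⌋ ≤ 2βm` pairs),
`∑_{j,a} δ_{j,a} ≥ δ`, hence some pair has `δ_{j,a} ≥ δ/(2βm)`.
[cite: MicciancioRegev2007, Thm. 5.9 (proof, p. 23: "∑ δ_{j′,α′} ≥ δ. Hence … δ_{j′,α′} ≥ δ/2βm")] -/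
theorem exists_guess (B : RandAlg (List Bool) (List Bool)) (n m q : ℕ) [NeZero q] {β : ℝ}
    (hβ : 1 ≤ β) (hm : 0 < m) (E : Matrix (Fin n) (Fin m) (ZMod q) → Set (List Bool))
    (hE : ∀ A, ∀ w ∈ E A, decodeIntVec m w ≠ 0 ∧ ‖intVecToEuclidean m (decodeIntVec m w)‖ ≤ β) :
    ∃ j : Fin m, ∃ a : ℤ, a ≠ 0 ∧ |(a : ℝ)| ≤ β ∧
      matrixAvg n m q (fun A => B.pr id (encodeMatrix A) (E A)) / (2 * β * m) ≤
        matrixAvg n m q (fun A => B.pr id (encodeMatrix A) (E A ∩ {w | decodeIntVec m w j = a})) := by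
  classical
  -- the box `T = ⌊β⌋ ≥ 1` and the index set `K = [m] × ({-T..T} ∖ {0})`
  set T : ℕ := ⌊β⌋₊ with hT
  have hT1 : 1 ≤ T := Nat.le_floor (by exact_mod_cast hβ)
  have hTβ : (T : ℝ) ≤ β := Nat.floor_le (by linarith)
  set K : Finset (Fin m × ℤ) := Finset.univ ×ˢ ((Finset.Icc (-(T : ℤ)) T).erase 0) with hK
  have hKcard : (K.card : ℝ) = 2 * T * m := by
    rw [hK, Finset.card_product, Finset.card_univ, Fintype.card_fin, card_Icc_erase_zero]
    push_cast; ring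
  have hKpos : (0 : ℝ) < K.card := by
    rw [hKcard]; have : (0 : ℝ) < m := by exact_mod_cast hm
    have : (1 : ℝ) ≤ T := by exact_mod_cast hT1
    positivity
  have hKne : K.Nonempty := by
    rw [← Finset.card_pos]; exact_mod_cast hKpos
  -- every success event is covered by the events `z_j = a`, `(j, a) ∈ K`
  have hcover : ∀ A, E A ⊆ ⋃ k ∈ K, (E A ∩ {w | decodeIntVec m w k.1 = k.2}) := by
    intro A w hw
    obtain ⟨j, hj0, hjβ⟩ := exists_coord_ne_zero_abs_le (hE A w hw).1 (hE A w hw).2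
    simp only [Set.mem_iUnion, Set.mem_inter_iff, Set.mem_setOf_eq, exists_prop]
    refine ⟨(j, decodeIntVec m w j), ?_, hw, rfl⟩
    rw [hK, Finset.mem_product, Finset.mem_erase, Finset.mem_Icc]
    refine ⟨Finset.mem_univ _, hj0, ?_⟩
    have habs : |decodeIntVec m w j| ≤ (T : ℤ) := by
      have h1 : ((|decodeIntVec m w j| : ℤ) : ℝ) ≤ β := by push_cast; exact hjβ
      have h2 : |decodeIntVec m w j| ≤ ⌊β⌋ := Int.le_floor.2 h1
      rwa [← Int.natCast_floor_eq_floor (by linarith : (0 : ℝ) ≤ β)] at h2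
    exact abs_le.1 habs
  -- hence `Pr[E_A] ≤ ∑_{(j,a) ∈ K} Pr[E_A ∧ z_j = a]` for every `A`, and the same for the averages
  have hpr : ∀ A, B.pr id (encodeMatrix A) (E A) ≤
      ∑ k ∈ K, B.pr id (encodeMatrix A) (E A ∩ {w | decodeIntVec m w k.1 = k.2}) := by
    intro A
    unfold RandAlg.pr
    exact (ENNReal.toReal_mono (PMF.toOuterMeasure_ne_top _ _)
      (PMF.toOuterMeasure_mono _ (Set.inter_subset_left.trans (hcover A)))).trans
      (PMF.toReal_toOuterMeasure_biUnion_finset_le _ K _)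
  have havg : matrixAvg n m q (fun A => B.pr id (encodeMatrix A) (E A)) ≤
      ∑ k ∈ K, matrixAvg n m q
        (fun A => B.pr id (encodeMatrix A) (E A ∩ {w | decodeIntVec m w k.1 = k.2})) := by
    unfold matrixAvg
    rw [← Finset.sum_div, Finset.sum_comm]
    exact div_le_div_of_nonneg_right (Finset.sum_le_sum fun A _ => hpr A) (by positivity)
  -- pigeonhole over `K`
  set δ : ℝ := matrixAvg n m q (fun A => B.pr id (encodeMatrix A) (E A)) with hδ
  have hδ0 : 0 ≤ δ := matrixAvg_nonneg fun A => B.pr_nonneg _ _ _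
  have hconst : ∑ _k ∈ K, δ / K.card = δ := by
    rw [Finset.sum_const, nsmul_eq_mul, mul_div_cancel₀ _ hKpos.ne']
  obtain ⟨⟨j, a⟩, hk, hle⟩ := Finset.exists_le_of_sum_le hKne (hconst.trans_le havg)
  rw [hK, Finset.mem_product, Finset.mem_erase, Finset.mem_Icc] at hk
  refine ⟨j, a, hk.2.1, ?_, le_trans ?_ hle⟩
  · have : ((|a| : ℤ) : ℝ) ≤ T := by exact_mod_cast abs_le.2 hk.2.2
    push_cast at this
    exact this.trans hTβ
  · rw [hKcard]
    have hm' : (0 : ℝ) ≤ (m : ℝ) := Nat.cast_nonneg m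
    exact div_le_div_of_nonneg_left hδ0 (hKpos.trans_eq hKcard) (by nlinarith [hTβ, hm'])

end Literature.Computability.Cryptography.SIS

end
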